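import Mathlib
import HarnessLib
import Summits.HubbardSuperconductivity.HubbardSuperconductivity.Theorems.KLProgrammeKLRegimeEngineFrameShiftDressingSymbols
import Summits.HubbardSuperconductivity.HubbardSuperconductivity.Theorems.KLProgrammeKLRegimeEngineLastStepFrameIdentity
import Summits.HubbardSuperconductivity.HubbardSuperconductivity.Theorems.KLProgrammeKLRegimeEngineLastRespProfiles

/-!
# K3 gen-8-FLOW (stmt 20437, stub (C), located item #20, cure (δ′) «LAST-STEP SWAP», response door layer C1): the THREE CONTINUUM SYMBOLS of the
# last-step response are p2 g14's dressing symbols for the REVERSED frame pair `(K_N, K_{n_β})` at weight one — identification with the native response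
# data of `…EngineLastStepFrameIdentity` §5, symmetry/smoothness, and their reduction ON THE OLD FERMI CURVE to the three scalar profiles of layer B1

Cell gate-hubbard-kl, seat p2 g17.  With `Kn := K_N` (new frame), `Ko := K_{n_β}` (old frame) the band pair of `…EngineFrameShiftDressingSymbols` for the pair
`(K₁, K₂) := (Kn, Ko)` is `u = e_{Ko}` (OLD band), `v = evalM (Ko ⊖ Kn)` (`= +piece_{n_β}`; `u + v = e_{Kn}`), and at the last index (`ω = ω_i`, `|ω_i| ≥ Λ_N`,
weight `w ≡ 1`) its dressing parameter `κΨ̃ = (v/c)·w·R_c(u + w·v)` samples to `(Ko ⊖ Kn)(p_k⃗)/(−iω + e_{Kn}(k⃗)) = −v_last` where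
`v_last = (Kn ⊖ Ko)(p_k⃗)/(−iω + e_{Kn}(k⃗))` is the dressing parameter of the last-step identity (`…LastStepFrameIdentity` §4–§5).  Hence

  `J₁ := (κΨ̃)·(κΨ̃) − 2·κΨ̃`  samples to `b = 2v_last + v_last²`,   `−J₂ := ((v·v)/c)·Ψ̃` samples to `D̂·v_last`,

and the response data of `klLocSelfEnergyRe_frame_sub_eq_last_native` are the sum of THREE dressed real data `Re(g(p_k⃗)·h(k⃗))` (§2) with
`(g, h) = (−J₂, 1)`, `(J₁, klLocSelfEnergyRe … Kn N)` (sign `−`), `(−i·J₁, ¼Σ_σ[Im Σ_N[Kn](ω₀) − Im Σ_N[Kn](−ω₀)])`.  The three `g` are smooth,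
`2π`-periodic and `D₄`-symmetric (§3: p2 g14's `contDiff_dressingJ₁Symbol` / `_J₂Symbol`, `bandPair_comp_invariant`), and ON THE OLD CURVE
(`e_{Ko}(γ θ) = 0`) they are the layer-B1 profiles of `t(θ) := (Kn ⊖ Ko)(γ θ)/ω₀`: `Re J₁ = t²(ι − 2ι²)`, `Re(−i·J₁) = Im J₁ = t·2ι²`, `Re(−J₂) = ω₀·t³·ι`,
`ι = Im r(t)`, `r = resolventFnXi 1 0 (−1)` (§4) — so layer B2 applies with the TANGENTIAL jets of layer B1.

* §1 `lastKappa_sample` (`κΨ̃(p_k⃗) = −v_last`), `lastJ₁_sample` (`= 2v_last + v_last²`), `lastNegJ₂_sample` (`= D̂·v_last`);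
* §2 **`lastRespData_eq_three_dressed`** — `klLocSelfEnergyRe … Kn N k − D̂ − klLocSelfEnergyRe … Ko N k = Re(−J₂(p_k)·1) − Re(J₁(p_k)·σ(k)) + Re((−i·J₁)(p_k)·A(k))`;
* §3 smoothness of `J₁`, `−i·J₁`, `−J₂` (one-liners on p2 g14); §4 **`lastJ₁_onCurve_re/_im`**, **`lastNegJ₂_onCurve_re`** — the profile identities on the old curve.

Proofs only; no definitions; no sizes asserted; nothing asserts superconductivity.  Refs: BGM 2006 §2.2 (2.23), §2.4 (2.36) [cite: BenfattoGiulianiMastropietro2006]; FST 1996 §1 [cite: FeldmanSalmhoferTrubowitz1996].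
-/

noncomputable section

namespace Summit.HubbardSuperconductivity.HubbardSuperconductivity.Theorems.EngineV8

set_option linter.dupNamespace false -- summit = problem name (single-conjunct summit), D-0017

open Complex Real Finset Filter Literature.MathematicalPhysics.QuantumLattice Literature.Probability.LatticeModels
open Summit.HubbardSuperconductivity.HubbardSuperconductivity.Theorems.KLRegimeSplit
open Summit.HubbardSuperconductivity.HubbardSuperconductivity.Theorems.DispersionFlow
open Summit.HubbardSuperconductivity.HubbardSuperconductivity.Theorems.KLProgrammeLegKernels

variable {L M : ℕ} [NeZero L]

/-! ## §1 Sampling the reversed-pair dressing symbols at the last index -/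

section Sample

variable {β : ℝ} (hβ : 0 < β) {N : ℕ} (hN : nScales β < N) (μ : ℝ) (Ko Kn : TrigPolyC4v)
include hβ hN

/-- At the last index the weight of the reversed pair's band is one at every lattice momentum and every frequency:
`uvWeightFn Λ_N ω_i (e_{Ko}(p_k⃗)) = 1`. -/
theorem lastWeight_eq_one (i : MatsubaraIdx M) (q : Momentum) :
    uvWeightFn (klScale klE0 N) (matsubaraFreq β M i) (frameLevel μ Ko q) = 1 :=
  uvWeightFn_eq_one_of_ge (klth_klScale_pos N) (by
    have h := sq_klScale_le_of_nScales_lt (M := M) hβ hN i (frameLevel μ Ko q)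
    linarith [sq_nonneg (frameLevel μ Ko q), sq_nonneg (matsubaraFreq β M i)])

/-- **`κΨ̃(p_k⃗) = −v_last`**: the reversed pair's dressing parameter samples to minus the last-step dressing parameter
`(Kn ⊖ Ko)(p_k⃗)/(−iω_i + e_{Kn}(k⃗))`. -/
theorem lastKappa_sample (i : MatsubaraIdx M) (kv : TorusSite 2 L) :
    (fun q : Momentum => (((evalM (fsub Ko Kn) q / (β * (L : ℝ) ^ 2) : ℝ)) : ℂ) *
        (((uvWeightFn (klScale klE0 N) (matsubaraFreq β M i) (frameLevel μ Ko q) : ℝ) : ℂ) *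
          resolventFnXi (β * (L : ℝ) ^ 2) 0 (matsubaraFreq β M i) (frameLevel μ Ko q +
            uvWeightFn (klScale klE0 N) (matsubaraFreq β M i) (frameLevel μ Ko q) * evalM (fsub Ko Kn) q))) (WithLp.toLp 2 (latticeMomentum L kv)) =
      -((((fsub Kn Ko).eval (latticeMomentum L kv) : ℝ) : ℂ) / (-I * ((matsubaraFreq β M i : ℝ) : ℂ) + ((nambuXiCT L μ Kn kv : ℝ) : ℂ))) := by
  have hL : (0 : ℝ) < L := by exact_mod_cast NeZero.pos L
  have hc : (β * (L : ℝ) ^ 2) ≠ 0 := by positivity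
  have hω : matsubaraFreq β M i ≠ 0 := matsubaraFreq_ne_zero hβ.ne' i
  simp only [lastWeight_eq_one hβ hN μ Ko, Complex.ofReal_one, one_mul]
  have hsum : frameLevel μ Ko (WithLp.toLp 2 (latticeMomentum L kv)) + evalM (fsub Ko Kn) (WithLp.toLp 2 (latticeMomentum L kv)) =
      nambuXiCT L μ Kn kv := by rw [frameLevel_add_evalM_fsub, EngineV8.nambuXiCT_eq_frameLevel]
  rw [hsum]
  have hv : evalM (fsub Ko Kn) (WithLp.toLp 2 (latticeMomentum L kv)) = -((fsub Kn Ko).eval (latticeMomentum L kv)) := by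
    rw [evalM_fsub, evalM_apply, evalM_apply, eval_fsub]; simp
  rw [hv]
  unfold resolventFnXi
  rw [add_zero]
  push_cast
  have hz : (-(I * ((matsubaraFreq β M i : ℝ) : ℂ)) + ((nambuXiCT L μ Kn kv : ℝ) : ℂ)) ≠ 0 := by
    intro h; have := congrArg Complex.im h; simp at this; exact hω this
  have hβC : (β : ℂ) ≠ 0 := by exact_mod_cast hβ.ne'
  have hLC : (L : ℂ) ≠ 0 := by exact_mod_cast hL.ne'
  field_simp

/-- **`J₁(p_k⃗) = 2v_last + v_last²`** (with `v_last` at frequency `ω_i`). -/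
theorem lastJ₁_sample (i : MatsubaraIdx M) (kv : TorusSite 2 L) :
    (fun q : Momentum =>
      ((((evalM (fsub Ko Kn) q / (β * (L : ℝ) ^ 2) : ℝ)) : ℂ) * (((uvWeightFn (klScale klE0 N) (matsubaraFreq β M i) (frameLevel μ Ko q) : ℝ) : ℂ) *
          resolventFnXi (β * (L : ℝ) ^ 2) 0 (matsubaraFreq β M i) (frameLevel μ Ko q +
            uvWeightFn (klScale klE0 N) (matsubaraFreq β M i) (frameLevel μ Ko q) * evalM (fsub Ko Kn) q))) *
        ((((evalM (fsub Ko Kn) q / (β * (L : ℝ) ^ 2) : ℝ)) : ℂ) * (((uvWeightFn (klScale klE0 N) (matsubaraFreq β M i) (frameLevel μ Ko q) : ℝ) : ℂ) *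
          resolventFnXi (β * (L : ℝ) ^ 2) 0 (matsubaraFreq β M i) (frameLevel μ Ko q +
            uvWeightFn (klScale klE0 N) (matsubaraFreq β M i) (frameLevel μ Ko q) * evalM (fsub Ko Kn) q))) -
      (2 : ℂ) * ((((evalM (fsub Ko Kn) q / (β * (L : ℝ) ^ 2) : ℝ)) : ℂ) * (((uvWeightFn (klScale klE0 N) (matsubaraFreq β M i) (frameLevel μ Ko q) : ℝ) : ℂ) *
          resolventFnXi (β * (L : ℝ) ^ 2) 0 (matsubaraFreq β M i) (frameLevel μ Ko q +
            uvWeightFn (klScale klE0 N) (matsubaraFreq β M i) (frameLevel μ Ko q) * evalM (fsub Ko Kn) q)))) (WithLp.toLp 2 (latticeMomentum L kv)) =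
      2 * ((((fsub Kn Ko).eval (latticeMomentum L kv) : ℝ) : ℂ) / (-I * ((matsubaraFreq β M i : ℝ) : ℂ) + ((nambuXiCT L μ Kn kv : ℝ) : ℂ))) +
        ((((fsub Kn Ko).eval (latticeMomentum L kv) : ℝ) : ℂ) / (-I * ((matsubaraFreq β M i : ℝ) : ℂ) + ((nambuXiCT L μ Kn kv : ℝ) : ℂ))) ^ 2 := by
  have h := lastKappa_sample (L := L) hβ hN μ Ko Kn i kv
  simp only at h ⊢
  rw [h]
  ring

/-- **`−J₂(p_k⃗) = D̂·v_last`** (`D̂ = (Kn ⊖ Ko)(p_k⃗)`). -/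
theorem lastNegJ₂_sample (i : MatsubaraIdx M) (kv : TorusSite 2 L) :
    (fun q : Momentum => (((((evalM (fsub Ko Kn) q * evalM (fsub Ko Kn) q) / (β * (L : ℝ) ^ 2) : ℝ)) : ℂ) *
        (((uvWeightFn (klScale klE0 N) (matsubaraFreq β M i) (frameLevel μ Ko q) : ℝ) : ℂ) *
          resolventFnXi (β * (L : ℝ) ^ 2) 0 (matsubaraFreq β M i) (frameLevel μ Ko q +
            uvWeightFn (klScale klE0 N) (matsubaraFreq β M i) (frameLevel μ Ko q) * evalM (fsub Ko Kn) q)))) (WithLp.toLp 2 (latticeMomentum L kv)) =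
      (((fsub Kn Ko).eval (latticeMomentum L kv) : ℝ) : ℂ) *
        ((((fsub Kn Ko).eval (latticeMomentum L kv) : ℝ) : ℂ) / (-I * ((matsubaraFreq β M i : ℝ) : ℂ) + ((nambuXiCT L μ Kn kv : ℝ) : ℂ))) := by
  have hL : (0 : ℝ) < L := by exact_mod_cast NeZero.pos L
  have hω : matsubaraFreq β M i ≠ 0 := matsubaraFreq_ne_zero hβ.ne' i
  simp only [lastWeight_eq_one hβ hN μ Ko, Complex.ofReal_one, one_mul]
  have hsum : frameLevel μ Ko (WithLp.toLp 2 (latticeMomentum L kv)) + evalM (fsub Ko Kn) (WithLp.toLp 2 (latticeMomentum L kv)) =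
      nambuXiCT L μ Kn kv := by rw [frameLevel_add_evalM_fsub, EngineV8.nambuXiCT_eq_frameLevel]
  rw [hsum]
  have hv : evalM (fsub Ko Kn) (WithLp.toLp 2 (latticeMomentum L kv)) = -((fsub Kn Ko).eval (latticeMomentum L kv)) := by
    rw [evalM_fsub, evalM_apply, evalM_apply, eval_fsub]; simp
  rw [hv]
  unfold resolventFnXi
  rw [add_zero]
  push_cast
  have hz : (-(I * ((matsubaraFreq β M i : ℝ) : ℂ)) + ((nambuXiCT L μ Kn kv : ℝ) : ℂ)) ≠ 0 := by
    intro h; have := congrArg Complex.im h; simp at this; exact hω this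
  have hβC : (β : ℂ) ≠ 0 := by exact_mod_cast hβ.ne'
  have hLC : (L : ℂ) ≠ 0 := by exact_mod_cast hL.ne'
  field_simp

end Sample

/-! ## §2 The native response data are three dressed real data -/

section Data

variable {β : ℝ} (hβ : 0 < β) (U μ : ℝ) (Ko Kn : TrigPolyC4v) {N : ℕ} (hN : nScales β < N) [NeZero M]
  (hZn : IsUnit (effPartitionFn ℂ (normalCovariance L M (uvSymbolCT L M β μ Kn (klScale klE0 N)))
    (hubbardInteraction L M β U + counterQuadratic L M β Kn)))
  (hZo : IsUnit (effPartitionFn ℂ (normalCovariance L M (uvSymbolCT L M β μ Ko (klScale klE0 N)))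
    (hubbardInteraction L M β U + counterQuadratic L M β Ko)))
include hβ hN hZn hZo

/-- **THE RESPONSE DATA AS THREE DRESSED REAL DATA** (`ω₀ = π/β = matsubaraFreq (omega0 M)`): with the reversed pair's symbols `J₁`, `−J₂` at frequency `ω₀`,
`klLocSelfEnergyRe … Kn N k − (Kn ⊖ Ko)(p_k) − klLocSelfEnergyRe … Ko N k = Re(−J₂(p_k)·1) − Re(J₁(p_k)·σ(k)) + Re((−i·J₁(p_k))·A(k))`,
`σ = klLocSelfEnergyRe … Kn N`, `A = ¼Σ_σ[Im Σ_N[Kn](ω₀,k,σ) − Im Σ_N[Kn](−ω₀,k,σ)]` (both REAL lattice data). -/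
theorem lastRespData_eq_three_dressed (kv : TorusSite 2 L) :
    klLocSelfEnergyRe L M β U μ Kn N kv - (fsub Kn Ko).eval (latticeMomentum L kv) - klLocSelfEnergyRe L M β U μ Ko N kv =
      ((fun q : Momentum => (((((evalM (fsub Ko Kn) q * evalM (fsub Ko Kn) q) / (β * (L : ℝ) ^ 2) : ℝ)) : ℂ) *
          (((uvWeightFn (klScale klE0 N) (matsubaraFreq β M (omega0 M)) (frameLevel μ Ko q) : ℝ) : ℂ) *
            resolventFnXi (β * (L : ℝ) ^ 2) 0 (matsubaraFreq β M (omega0 M)) (frameLevel μ Ko q +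
              uvWeightFn (klScale klE0 N) (matsubaraFreq β M (omega0 M)) (frameLevel μ Ko q) * evalM (fsub Ko Kn) q))))
          (WithLp.toLp 2 (latticeMomentum L kv)) * (((1 : ℝ) : ℝ) : ℂ)).re -
      ((fun q : Momentum =>
        ((((evalM (fsub Ko Kn) q / (β * (L : ℝ) ^ 2) : ℝ)) : ℂ) * (((uvWeightFn (klScale klE0 N) (matsubaraFreq β M (omega0 M)) (frameLevel μ Ko q) : ℝ) : ℂ) *
            resolventFnXi (β * (L : ℝ) ^ 2) 0 (matsubaraFreq β M (omega0 M)) (frameLevel μ Ko q +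
              uvWeightFn (klScale klE0 N) (matsubaraFreq β M (omega0 M)) (frameLevel μ Ko q) * evalM (fsub Ko Kn) q))) *
          ((((evalM (fsub Ko Kn) q / (β * (L : ℝ) ^ 2) : ℝ)) : ℂ) * (((uvWeightFn (klScale klE0 N) (matsubaraFreq β M (omega0 M)) (frameLevel μ Ko q) : ℝ) : ℂ) *
            resolventFnXi (β * (L : ℝ) ^ 2) 0 (matsubaraFreq β M (omega0 M)) (frameLevel μ Ko q +
              uvWeightFn (klScale klE0 N) (matsubaraFreq β M (omega0 M)) (frameLevel μ Ko q) * evalM (fsub Ko Kn) q))) -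
        (2 : ℂ) * ((((evalM (fsub Ko Kn) q / (β * (L : ℝ) ^ 2) : ℝ)) : ℂ) * (((uvWeightFn (klScale klE0 N) (matsubaraFreq β M (omega0 M)) (frameLevel μ Ko q) : ℝ) : ℂ) *
            resolventFnXi (β * (L : ℝ) ^ 2) 0 (matsubaraFreq β M (omega0 M)) (frameLevel μ Ko q +
              uvWeightFn (klScale klE0 N) (matsubaraFreq β M (omega0 M)) (frameLevel μ Ko q) * evalM (fsub Ko Kn) q))))
          (WithLp.toLp 2 (latticeMomentum L kv)) * ((klLocSelfEnergyRe L M β U μ Kn N kv : ℝ) : ℂ)).re +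
      ((-I * (fun q : Momentum =>
        ((((evalM (fsub Ko Kn) q / (β * (L : ℝ) ^ 2) : ℝ)) : ℂ) * (((uvWeightFn (klScale klE0 N) (matsubaraFreq β M (omega0 M)) (frameLevel μ Ko q) : ℝ) : ℂ) *
            resolventFnXi (β * (L : ℝ) ^ 2) 0 (matsubaraFreq β M (omega0 M)) (frameLevel μ Ko q +
              uvWeightFn (klScale klE0 N) (matsubaraFreq β M (omega0 M)) (frameLevel μ Ko q) * evalM (fsub Ko Kn) q))) *
          ((((evalM (fsub Ko Kn) q / (β * (L : ℝ) ^ 2) : ℝ)) : ℂ) * (((uvWeightFn (klScale klE0 N) (matsubaraFreq β M (omega0 M)) (frameLevel μ Ko q) : ℝ) : ℂ) *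
            resolventFnXi (β * (L : ℝ) ^ 2) 0 (matsubaraFreq β M (omega0 M)) (frameLevel μ Ko q +
              uvWeightFn (klScale klE0 N) (matsubaraFreq β M (omega0 M)) (frameLevel μ Ko q) * evalM (fsub Ko Kn) q))) -
        (2 : ℂ) * ((((evalM (fsub Ko Kn) q / (β * (L : ℝ) ^ 2) : ℝ)) : ℂ) * (((uvWeightFn (klScale klE0 N) (matsubaraFreq β M (omega0 M)) (frameLevel μ Ko q) : ℝ) : ℂ) *
            resolventFnXi (β * (L : ℝ) ^ 2) 0 (matsubaraFreq β M (omega0 M)) (frameLevel μ Ko q +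
              uvWeightFn (klScale klE0 N) (matsubaraFreq β M (omega0 M)) (frameLevel μ Ko q) * evalM (fsub Ko Kn) q))))
          (WithLp.toLp 2 (latticeMomentum L kv))) *
        (((∑ s : Fin 2, ((klSelfEnergy L M β U μ Kn klE0 N (omega0 M, kv) s).im -
            (klSelfEnergy L M β U μ Kn klE0 N ((omega0 M).rev, kv) s).im)) / 4 : ℝ) : ℂ)).re := by
  rw [klLocSelfEnergyRe_frame_sub_eq_last_native hβ U μ Ko Kn hN hZn hZo kv, lastNegJ₂_sample (L := L) hβ hN μ Ko Kn (omega0 M) kv,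
    lastJ₁_sample (L := L) hβ hN μ Ko Kn (omega0 M) kv, matsubaraFreq_omega0 M β]
  set v : ℂ := (((fsub Kn Ko).eval (latticeMomentum L kv) : ℝ) : ℂ) / (-I * ((Real.pi / β : ℝ) : ℂ) + ((nambuXiCT L μ Kn kv : ℝ) : ℂ)) with hv
  set b : ℂ := 2 * v + v ^ 2 with hb
  simp only [Complex.ofReal_one, mul_one, Complex.mul_re, Complex.neg_re, Complex.neg_im, Complex.I_re, Complex.I_im,
    Complex.ofReal_re, Complex.ofReal_im]
  ring

end Data

/-! ## §3 Smoothness, periodicity and `D₄`-symmetry of the three symbols -/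

section Symm

variable (μ : ℝ) (Ko Kn : TrigPolyC4v) (c Λ ω : ℝ)

omit [NeZero L] in
/-- `J₁` of the reversed pair is smooth (`ω ≠ 0`). -/
theorem contDiff_lastJ₁ (hω : ω ≠ 0) :
    ContDiff ℝ (⊤ : ℕ∞) (fun q : Momentum =>
      ((((evalM (fsub Ko Kn) q / c : ℝ)) : ℂ) * (((uvWeightFn Λ ω (frameLevel μ Ko q) : ℝ) : ℂ) *
          resolventFnXi c 0 ω (frameLevel μ Ko q + uvWeightFn Λ ω (frameLevel μ Ko q) * evalM (fsub Ko Kn) q))) *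
        ((((evalM (fsub Ko Kn) q / c : ℝ)) : ℂ) * (((uvWeightFn Λ ω (frameLevel μ Ko q) : ℝ) : ℂ) *
          resolventFnXi c 0 ω (frameLevel μ Ko q + uvWeightFn Λ ω (frameLevel μ Ko q) * evalM (fsub Ko Kn) q))) -
      (2 : ℂ) * ((((evalM (fsub Ko Kn) q / c : ℝ)) : ℂ) * (((uvWeightFn Λ ω (frameLevel μ Ko q) : ℝ) : ℂ) *
          resolventFnXi c 0 ω (frameLevel μ Ko q + uvWeightFn Λ ω (frameLevel μ Ko q) * evalM (fsub Ko Kn) q)))) :=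
  contDiff_dressingJ₁Symbol μ Kn Ko c Λ ω hω

omit [NeZero L] in
/-- `−i·J₁` is smooth. -/
theorem contDiff_negI_lastJ₁ (hω : ω ≠ 0) :
    ContDiff ℝ (⊤ : ℕ∞) (fun q : Momentum => -I * (
      ((((evalM (fsub Ko Kn) q / c : ℝ)) : ℂ) * (((uvWeightFn Λ ω (frameLevel μ Ko q) : ℝ) : ℂ) *
          resolventFnXi c 0 ω (frameLevel μ Ko q + uvWeightFn Λ ω (frameLevel μ Ko q) * evalM (fsub Ko Kn) q))) *
        ((((evalM (fsub Ko Kn) q / c : ℝ)) : ℂ) * (((uvWeightFn Λ ω (frameLevel μ Ko q) : ℝ) : ℂ) *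
          resolventFnXi c 0 ω (frameLevel μ Ko q + uvWeightFn Λ ω (frameLevel μ Ko q) * evalM (fsub Ko Kn) q))) -
      (2 : ℂ) * ((((evalM (fsub Ko Kn) q / c : ℝ)) : ℂ) * (((uvWeightFn Λ ω (frameLevel μ Ko q) : ℝ) : ℂ) *
          resolventFnXi c 0 ω (frameLevel μ Ko q + uvWeightFn Λ ω (frameLevel μ Ko q) * evalM (fsub Ko Kn) q))))) :=
  contDiff_const.mul (contDiff_lastJ₁ μ Ko Kn c Λ ω hω)

omit [NeZero L] in
/-- `−J₂ = ((v·v)/c)·Ψ̃` is smooth. -/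
theorem contDiff_lastNegJ₂ (hω : ω ≠ 0) :
    ContDiff ℝ (⊤ : ℕ∞) (fun q : Momentum => (((((evalM (fsub Ko Kn) q * evalM (fsub Ko Kn) q) / c : ℝ)) : ℂ) *
      (((uvWeightFn Λ ω (frameLevel μ Ko q) : ℝ) : ℂ) *
        resolventFnXi c 0 ω (frameLevel μ Ko q + uvWeightFn Λ ω (frameLevel μ Ko q) * evalM (fsub Ko Kn) q)))) :=
  (Complex.ofRealCLM.contDiff.comp (((contDiff_evalM _).mul (contDiff_evalM _)).div_const c)).mul
    (contDiff_resummedSymbol μ Kn Ko c Λ ω hω)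

end Symm

/-! ## §4 On the old Fermi curve: the three symbols are the layer-B1 profiles -/

omit [NeZero L] in
/-- Unit-resolvent algebra: `t·r(t) = 1 − i·r(t)` (`r(t) = 1/(t + i)`). -/
theorem ofReal_mul_unitResolvent_eq (t : ℝ) :
    (t : ℂ) * resolventFnXi 1 0 (-1) t = 1 - I * resolventFnXi 1 0 (-1) t := by
  rw [unitResolvent_eq]
  have hne : (t : ℂ) + I ≠ 0 := by
    intro h; have := congrArg Complex.im h; simp at this
  field_simp
  ring_nf

omit [NeZero L] in
/-- Unit-resolvent algebra: with `κ = t·r(t)`, `κ·κ − 2κ = −1 − r(t)²`. -/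
theorem unitKappa_sq_sub_two_mul (t : ℝ) :
    ((t : ℂ) * resolventFnXi 1 0 (-1) t) * ((t : ℂ) * resolventFnXi 1 0 (-1) t) - 2 * ((t : ℂ) * resolventFnXi 1 0 (-1) t) =
      -1 - (resolventFnXi 1 0 (-1) t) ^ 2 := by
  rw [ofReal_mul_unitResolvent_eq]
  linear_combination (resolventFnXi 1 0 (-1) t) ^ 2 * Complex.I_mul_I

section OnCurve

variable {β : ℝ} (hβ : 0 < β) {N : ℕ} (hN : nScales β < N) (μ : ℝ) (Ko Kn : TrigPolyC4v) {γ : ℝ → Momentum}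
  (hcurve : ∀ θ : ℝ, frameLevel μ Ko (γ θ) = 0)
include hβ hN hcurve

/-- On the old curve the reversed pair's dressing parameter is `t·r(t)` with `t := (Kn ⊖ Ko)(γ θ)/ω₀`, `ω₀ = π/β`, `r = resolventFnXi 1 0 (−1)`:
`κΨ̃(γ θ) = t·r(t)`. -/
theorem lastKappa_onCurve [NeZero M] (θ : ℝ) :
    (((evalM (fsub Ko Kn) (γ θ) / (β * (L : ℝ) ^ 2) : ℝ)) : ℂ) *
        (((uvWeightFn (klScale klE0 N) (matsubaraFreq β M (omega0 M)) (frameLevel μ Ko (γ θ)) : ℝ) : ℂ) *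
          resolventFnXi (β * (L : ℝ) ^ 2) 0 (matsubaraFreq β M (omega0 M)) (frameLevel μ Ko (γ θ) +
            uvWeightFn (klScale klE0 N) (matsubaraFreq β M (omega0 M)) (frameLevel μ Ko (γ θ)) * evalM (fsub Ko Kn) (γ θ))) =
      (((evalM (fsub Kn Ko) (γ θ) / (Real.pi / β) : ℝ)) : ℂ) * resolventFnXi 1 0 (-1) (evalM (fsub Kn Ko) (γ θ) / (Real.pi / β)) := by
  have hL : (0 : ℝ) < L := by exact_mod_cast NeZero.pos L
  have hw0 : Real.pi / β ≠ 0 := by positivity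
  rw [lastWeight_eq_one hβ hN μ Ko, hcurve θ, matsubaraFreq_omega0 M β]
  have hv : evalM (fsub Ko Kn) (γ θ) = -evalM (fsub Kn Ko) (γ θ) := by rw [evalM_fsub, evalM_fsub]; ring
  rw [hv]
  set d : ℝ := evalM (fsub Kn Ko) (γ θ) with hd
  set w : ℝ := Real.pi / β with hw
  rw [unitResolvent_eq]
  unfold resolventFnXi
  rw [add_zero]
  push_cast
  have h5 : (-(I * (w : ℂ)) + (0 + -(d : ℂ))) ≠ 0 := by
    intro h; have := congrArg Complex.im h; simp at this; exact hw0 this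
  have h1 : (-(I * (w : ℂ)) + (0 + 1 * -(d : ℂ))) ≠ 0 := by simpa using h5
  have h2 : ((d : ℂ) / (w : ℂ) + I) ≠ 0 := by
    intro h; have := congrArg Complex.im h; simp at this
  have hwC : (w : ℂ) ≠ 0 := by exact_mod_cast hw0
  have hβC : (β : ℂ) ≠ 0 := by exact_mod_cast hβ.ne'
  have hLC : (L : ℂ) ≠ 0 := by exact_mod_cast hL.ne'
  have h3 : ((d : ℂ) + I * (w : ℂ)) ≠ 0 := by
    intro h; have := congrArg Complex.im h; simp at this; exact hw0 this
  field_simp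
  ring

/-- **On the old curve `J₁(γ θ) = −1 − r(t)²`**, `t = (Kn ⊖ Ko)(γ θ)/ω₀`. -/
theorem lastJ₁_onCurve [NeZero M] (θ : ℝ) :
    ((((evalM (fsub Ko Kn) (γ θ) / (β * (L : ℝ) ^ 2) : ℝ)) : ℂ) *
        (((uvWeightFn (klScale klE0 N) (matsubaraFreq β M (omega0 M)) (frameLevel μ Ko (γ θ)) : ℝ) : ℂ) *
          resolventFnXi (β * (L : ℝ) ^ 2) 0 (matsubaraFreq β M (omega0 M)) (frameLevel μ Ko (γ θ) +
            uvWeightFn (klScale klE0 N) (matsubaraFreq β M (omega0 M)) (frameLevel μ Ko (γ θ)) * evalM (fsub Ko Kn) (γ θ)))) *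
      ((((evalM (fsub Ko Kn) (γ θ) / (β * (L : ℝ) ^ 2) : ℝ)) : ℂ) *
        (((uvWeightFn (klScale klE0 N) (matsubaraFreq β M (omega0 M)) (frameLevel μ Ko (γ θ)) : ℝ) : ℂ) *
          resolventFnXi (β * (L : ℝ) ^ 2) 0 (matsubaraFreq β M (omega0 M)) (frameLevel μ Ko (γ θ) +
            uvWeightFn (klScale klE0 N) (matsubaraFreq β M (omega0 M)) (frameLevel μ Ko (γ θ)) * evalM (fsub Ko Kn) (γ θ)))) -
      (2 : ℂ) * ((((evalM (fsub Ko Kn) (γ θ) / (β * (L : ℝ) ^ 2) : ℝ)) : ℂ) *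
        (((uvWeightFn (klScale klE0 N) (matsubaraFreq β M (omega0 M)) (frameLevel μ Ko (γ θ)) : ℝ) : ℂ) *
          resolventFnXi (β * (L : ℝ) ^ 2) 0 (matsubaraFreq β M (omega0 M)) (frameLevel μ Ko (γ θ) +
            uvWeightFn (klScale klE0 N) (matsubaraFreq β M (omega0 M)) (frameLevel μ Ko (γ θ)) * evalM (fsub Ko Kn) (γ θ)))) =
      -1 - (resolventFnXi 1 0 (-1) (evalM (fsub Kn Ko) (γ θ) / (Real.pi / β))) ^ 2 := by
  rw [lastKappa_onCurve hβ hN μ Ko Kn hcurve θ]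
  exact unitKappa_sq_sub_two_mul _

/-- **`Re J₁(γ θ) = t²(ι − 2ι²)`**, `ι = Im r(t)` (layer-B1 profile `lastProfileRe`). -/
theorem lastJ₁_onCurve_re [NeZero M] (θ : ℝ) :
    (((((evalM (fsub Ko Kn) (γ θ) / (β * (L : ℝ) ^ 2) : ℝ)) : ℂ) *
        (((uvWeightFn (klScale klE0 N) (matsubaraFreq β M (omega0 M)) (frameLevel μ Ko (γ θ)) : ℝ) : ℂ) *
          resolventFnXi (β * (L : ℝ) ^ 2) 0 (matsubaraFreq β M (omega0 M)) (frameLevel μ Ko (γ θ) +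
            uvWeightFn (klScale klE0 N) (matsubaraFreq β M (omega0 M)) (frameLevel μ Ko (γ θ)) * evalM (fsub Ko Kn) (γ θ)))) *
      ((((evalM (fsub Ko Kn) (γ θ) / (β * (L : ℝ) ^ 2) : ℝ)) : ℂ) *
        (((uvWeightFn (klScale klE0 N) (matsubaraFreq β M (omega0 M)) (frameLevel μ Ko (γ θ)) : ℝ) : ℂ) *
          resolventFnXi (β * (L : ℝ) ^ 2) 0 (matsubaraFreq β M (omega0 M)) (frameLevel μ Ko (γ θ) +
            uvWeightFn (klScale klE0 N) (matsubaraFreq β M (omega0 M)) (frameLevel μ Ko (γ θ)) * evalM (fsub Ko Kn) (γ θ)))) -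
      (2 : ℂ) * ((((evalM (fsub Ko Kn) (γ θ) / (β * (L : ℝ) ^ 2) : ℝ)) : ℂ) *
        (((uvWeightFn (klScale klE0 N) (matsubaraFreq β M (omega0 M)) (frameLevel μ Ko (γ θ)) : ℝ) : ℂ) *
          resolventFnXi (β * (L : ℝ) ^ 2) 0 (matsubaraFreq β M (omega0 M)) (frameLevel μ Ko (γ θ) +
            uvWeightFn (klScale klE0 N) (matsubaraFreq β M (omega0 M)) (frameLevel μ Ko (γ θ)) * evalM (fsub Ko Kn) (γ θ))))).re =
      (evalM (fsub Kn Ko) (γ θ) / (Real.pi / β)) ^ 2 * ((resolventFnXi 1 0 (-1) (evalM (fsub Kn Ko) (γ θ) / (Real.pi / β))).im -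
        2 * (resolventFnXi 1 0 (-1) (evalM (fsub Kn Ko) (γ θ) / (Real.pi / β))).im ^ 2) := by
  rw [lastJ₁_onCurve hβ hN μ Ko Kn hcurve θ]
  exact (lastProfile_identities _).2.1

/-- **`Im J₁(γ θ) = t·2ι²`** (layer-B1 profile `lastProfileIm`). -/
theorem lastJ₁_onCurve_im [NeZero M] (θ : ℝ) :
    (((((evalM (fsub Ko Kn) (γ θ) / (β * (L : ℝ) ^ 2) : ℝ)) : ℂ) *
        (((uvWeightFn (klScale klE0 N) (matsubaraFreq β M (omega0 M)) (frameLevel μ Ko (γ θ)) : ℝ) : ℂ) *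
          resolventFnXi (β * (L : ℝ) ^ 2) 0 (matsubaraFreq β M (omega0 M)) (frameLevel μ Ko (γ θ) +
            uvWeightFn (klScale klE0 N) (matsubaraFreq β M (omega0 M)) (frameLevel μ Ko (γ θ)) * evalM (fsub Ko Kn) (γ θ)))) *
      ((((evalM (fsub Ko Kn) (γ θ) / (β * (L : ℝ) ^ 2) : ℝ)) : ℂ) *
        (((uvWeightFn (klScale klE0 N) (matsubaraFreq β M (omega0 M)) (frameLevel μ Ko (γ θ)) : ℝ) : ℂ) *
          resolventFnXi (β * (L : ℝ) ^ 2) 0 (matsubaraFreq β M (omega0 M)) (frameLevel μ Ko (γ θ) +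
            uvWeightFn (klScale klE0 N) (matsubaraFreq β M (omega0 M)) (frameLevel μ Ko (γ θ)) * evalM (fsub Ko Kn) (γ θ)))) -
      (2 : ℂ) * ((((evalM (fsub Ko Kn) (γ θ) / (β * (L : ℝ) ^ 2) : ℝ)) : ℂ) *
        (((uvWeightFn (klScale klE0 N) (matsubaraFreq β M (omega0 M)) (frameLevel μ Ko (γ θ)) : ℝ) : ℂ) *
          resolventFnXi (β * (L : ℝ) ^ 2) 0 (matsubaraFreq β M (omega0 M)) (frameLevel μ Ko (γ θ) +
            uvWeightFn (klScale klE0 N) (matsubaraFreq β M (omega0 M)) (frameLevel μ Ko (γ θ)) * evalM (fsub Ko Kn) (γ θ))))).im =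
      (evalM (fsub Kn Ko) (γ θ) / (Real.pi / β)) * (2 * (resolventFnXi 1 0 (-1) (evalM (fsub Kn Ko) (γ θ) / (Real.pi / β))).im ^ 2) := by
  rw [lastJ₁_onCurve hβ hN μ Ko Kn hcurve θ]
  exact (lastProfile_identities _).1

/-- **`Re(−i·J₁)(γ θ) = Im J₁(γ θ) = t·2ι²`**. -/
theorem lastNegIJ₁_onCurve_re [NeZero M] (θ : ℝ) :
    (-I * (((((evalM (fsub Ko Kn) (γ θ) / (β * (L : ℝ) ^ 2) : ℝ)) : ℂ) *
        (((uvWeightFn (klScale klE0 N) (matsubaraFreq β M (omega0 M)) (frameLevel μ Ko (γ θ)) : ℝ) : ℂ) *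
          resolventFnXi (β * (L : ℝ) ^ 2) 0 (matsubaraFreq β M (omega0 M)) (frameLevel μ Ko (γ θ) +
            uvWeightFn (klScale klE0 N) (matsubaraFreq β M (omega0 M)) (frameLevel μ Ko (γ θ)) * evalM (fsub Ko Kn) (γ θ)))) *
      ((((evalM (fsub Ko Kn) (γ θ) / (β * (L : ℝ) ^ 2) : ℝ)) : ℂ) *
        (((uvWeightFn (klScale klE0 N) (matsubaraFreq β M (omega0 M)) (frameLevel μ Ko (γ θ)) : ℝ) : ℂ) *
          resolventFnXi (β * (L : ℝ) ^ 2) 0 (matsubaraFreq β M (omega0 M)) (frameLevel μ Ko (γ θ) +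
            uvWeightFn (klScale klE0 N) (matsubaraFreq β M (omega0 M)) (frameLevel μ Ko (γ θ)) * evalM (fsub Ko Kn) (γ θ)))) -
      (2 : ℂ) * ((((evalM (fsub Ko Kn) (γ θ) / (β * (L : ℝ) ^ 2) : ℝ)) : ℂ) *
        (((uvWeightFn (klScale klE0 N) (matsubaraFreq β M (omega0 M)) (frameLevel μ Ko (γ θ)) : ℝ) : ℂ) *
          resolventFnXi (β * (L : ℝ) ^ 2) 0 (matsubaraFreq β M (omega0 M)) (frameLevel μ Ko (γ θ) +
            uvWeightFn (klScale klE0 N) (matsubaraFreq β M (omega0 M)) (frameLevel μ Ko (γ θ)) * evalM (fsub Ko Kn) (γ θ)))))).re =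
      (evalM (fsub Kn Ko) (γ θ) / (Real.pi / β)) * (2 * (resolventFnXi 1 0 (-1) (evalM (fsub Kn Ko) (γ θ) / (Real.pi / β))).im ^ 2) := by
  rw [← lastJ₁_onCurve_im (L := L) (M := M) hβ hN μ Ko Kn hcurve θ]
  simp only [neg_mul, Complex.neg_re, Complex.I_mul_re, neg_neg]

/-- **On the old curve `−J₂(γ θ) = ω₀·t·(−1 + i·r(t))`** (`= −ω₀ t² r(t)`). -/
theorem lastNegJ₂_onCurve [NeZero M] (θ : ℝ) :
    ((((evalM (fsub Ko Kn) (γ θ) * evalM (fsub Ko Kn) (γ θ)) / (β * (L : ℝ) ^ 2) : ℝ)) : ℂ) *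
        (((uvWeightFn (klScale klE0 N) (matsubaraFreq β M (omega0 M)) (frameLevel μ Ko (γ θ)) : ℝ) : ℂ) *
          resolventFnXi (β * (L : ℝ) ^ 2) 0 (matsubaraFreq β M (omega0 M)) (frameLevel μ Ko (γ θ) +
            uvWeightFn (klScale klE0 N) (matsubaraFreq β M (omega0 M)) (frameLevel μ Ko (γ θ)) * evalM (fsub Ko Kn) (γ θ))) =
      (((Real.pi / β : ℝ)) : ℂ) * ((((evalM (fsub Kn Ko) (γ θ) / (Real.pi / β)) : ℝ) : ℂ) * (-1 + I * resolventFnXi 1 0 (-1) (evalM (fsub Kn Ko) (γ θ) / (Real.pi / β)))) := by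
  have hw0 : Real.pi / β ≠ 0 := by positivity
  have hfac : ((((evalM (fsub Ko Kn) (γ θ) * evalM (fsub Ko Kn) (γ θ)) / (β * (L : ℝ) ^ 2) : ℝ)) : ℂ) *
        (((uvWeightFn (klScale klE0 N) (matsubaraFreq β M (omega0 M)) (frameLevel μ Ko (γ θ)) : ℝ) : ℂ) *
          resolventFnXi (β * (L : ℝ) ^ 2) 0 (matsubaraFreq β M (omega0 M)) (frameLevel μ Ko (γ θ) +
            uvWeightFn (klScale klE0 N) (matsubaraFreq β M (omega0 M)) (frameLevel μ Ko (γ θ)) * evalM (fsub Ko Kn) (γ θ))) =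
      (((evalM (fsub Ko Kn) (γ θ) : ℝ)) : ℂ) * ((((evalM (fsub Ko Kn) (γ θ) / (β * (L : ℝ) ^ 2) : ℝ)) : ℂ) *
        (((uvWeightFn (klScale klE0 N) (matsubaraFreq β M (omega0 M)) (frameLevel μ Ko (γ θ)) : ℝ) : ℂ) *
          resolventFnXi (β * (L : ℝ) ^ 2) 0 (matsubaraFreq β M (omega0 M)) (frameLevel μ Ko (γ θ) +
            uvWeightFn (klScale klE0 N) (matsubaraFreq β M (omega0 M)) (frameLevel μ Ko (γ θ)) * evalM (fsub Ko Kn) (γ θ)))) := by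
    push_cast; ring
  rw [hfac, lastKappa_onCurve hβ hN μ Ko Kn hcurve θ]
  have hv : evalM (fsub Ko Kn) (γ θ) = -((Real.pi / β) * (evalM (fsub Kn Ko) (γ θ) / (Real.pi / β))) := by
    rw [evalM_fsub, evalM_fsub]; field_simp; ring
  rw [hv, Complex.ofReal_neg, Complex.ofReal_mul]
  linear_combination (-(((Real.pi / β : ℝ)) : ℂ) * ((((evalM (fsub Kn Ko) (γ θ) / (Real.pi / β)) : ℝ)) : ℂ)) * ofReal_mul_unitResolvent_eq (evalM (fsub Kn Ko) (γ θ) / (Real.pi / β))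

/-- **`Re(−J₂)(γ θ) = ω₀·t³·ι`** (layer-B1 profile `lastProfileA`). -/
theorem lastNegJ₂_onCurve_re [NeZero M] (θ : ℝ) :
    (((((evalM (fsub Ko Kn) (γ θ) * evalM (fsub Ko Kn) (γ θ)) / (β * (L : ℝ) ^ 2) : ℝ)) : ℂ) *
        (((uvWeightFn (klScale klE0 N) (matsubaraFreq β M (omega0 M)) (frameLevel μ Ko (γ θ)) : ℝ) : ℂ) *
          resolventFnXi (β * (L : ℝ) ^ 2) 0 (matsubaraFreq β M (omega0 M)) (frameLevel μ Ko (γ θ) +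
            uvWeightFn (klScale klE0 N) (matsubaraFreq β M (omega0 M)) (frameLevel μ Ko (γ θ)) * evalM (fsub Ko Kn) (γ θ)))).re =
      (Real.pi / β) * ((evalM (fsub Kn Ko) (γ θ) / (Real.pi / β)) ^ 3 * (resolventFnXi 1 0 (-1) (evalM (fsub Kn Ko) (γ θ) / (Real.pi / β))).im) := by
  rw [lastNegJ₂_onCurve hβ hN μ Ko Kn hcurve θ, Complex.re_ofReal_mul]
  congr 1
  exact (lastProfile_identities _).2.2

end OnCurve

end Summit.HubbardSuperconductivity.HubbardSuperconductivity.Theorems.EngineV8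

end
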